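import Literature.AlgebraicGeometry.RelativeSpec.GeometricQuotientFreeRank
import Literature.AlgebraicGeometry.AbelianSchemes.AbelianSchemeQuotientHomDescent
import Literature.AlgebraicGeometry.Morphisms.FiniteFlatRankComp
import Literature.AlgebraicGeometry.Morphisms.FlatOfComp
import Mathlib.AlgebraicGeometry.ZariskisMainTheorem
import HarnessLib

/-!
# An isogeny killing a finite constant subgroup `K` and of degree `|K|` IS the quotient `A → A⁄K` ([MumfordAV1970] §7 Thm. 4, uniqueness)

Topic `Literature/AlgebraicGeometry/AbelianSchemes`, namespace `Literature.AlgebraicGeometry.AbelianSchemes.AbelianSchemeOver`.  THEOREMS ONLY (no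
definition, no named fact, no instance, no notation, no `sorry`).  Cell `pub/hodgecm-mathlib` (D-0151 ∕ D-0183 floor 0), P6 «MOD programme», sub-line P6c
«DICT» organ **(o-c3h)** (desk F0P6c-plan 14:31:29Z: «an isogeny with prescribed constant kernel is the quotient», RANK FORM; consumers: DICT (c2)
`red_quotΩ` étale branch, HEART (c3b) «`𝒜_{quot x̄ H} ≅ 𝒜_x̄⁄H`» for an étale = constant `H` over `κ̄`; the `ker F` branch is the sibling ★
`AbelianVarietyRelFrobeniusFactorIso.isIso_of_relFrobenius_comp_eq`).  Over ★ `AbelianSchemeConstSubgroupQuotient` (`quotientMk = ψ : A → A⁄K`,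
`quotientActionOver`, `isGeometricQuotient_quotientActionOver`, `quotientActionOver_free`, `isProper_quotientOver_hom`), ★ `AbelianSchemeQuotientHomDescent`
(`homDesc`, `quotientMk_comp_homDesc`), ★ `RelativeSpec/GeometricQuotientFreeRank` (`ψ` has rank `|K|` everywhere), ★ `Morphisms/FiniteFlatRankComp`
(`finrank_comp_eq_mul`), ★ `Morphisms/FlatOfComp` (`Flat.of_comp_of_surjective`) and Mathlib (`IsFinite.of_isProper_of_locallyQuasiFinite`,
`Scheme.Hom.isIso_iff_finrank_eq`).  Generic, count-neutral capital `--supports stmt-HodgeConjecture-24832`.  HONEST LABEL: HC_CM is proved only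
modulo the printed citations until rung 0 closes; this file pays no letter.

THE STATEMENT (over a FIELD `k`; `A`, `B` abelian schemes over `Spec k`, `K ≤ A(k)` a finite subgroup acting freely on geometric points, `hcov` a
cover of `A` by `K`-stable affine opens): if a `K`-invariant `φ : A → B` over `Spec k` is FINITE and FLAT of rank `|K|` at every point of `B`, then the
descended morphism `homDesc φ : A⁄K → B` (`ψ ≫ homDesc φ = φ`) is an ISOMORPHISM.  Proof: `ψ` is finite flat of rank `|K|` (free quotient), so
`h = homDesc φ` is flat (`ψ` faithfully flat, `ψ ≫ h = φ` flat), proper (`A⁄K` proper, `B` separated) with finite fibres (contained in `ψ(φ⁻¹ b)`),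
hence finite (Zariski); ranks multiply: `|K| = rk φ = |K| · rk h`, so `rk h = 1` and `h` is an isomorphism.

* `finite_preimage_singleton_of_comp` (plumbing) · **`isIso_homDesc_of_finrank_eq_natCard`** (the head) · `isIso_left_homDesc_of_finrank_eq_natCard`.
* §2 (ED. 2): over a field `hfree` is automatic — `epi_fieldPoint`, `restrict_injective_of_field`, `translation_free_of_field`, and the
  hypothesis-light heads **`isIso_homDesc_of_finrank_eq_natCard_of_field`** · `isIso_left_homDesc_of_finrank_eq_natCard_of_field`.

## References
* [MumfordAV1970] D. Mumford, *Abelian Varieties* (1970), §7 Thm. 4 (p. 72) (quotient by a finite subgroup; every isogeny killing `K` factors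
  uniquely through `A → A⁄K`) and §12 Thm. 1 (p. 112) (degree of a free quotient).
* [GortzWedhorn2023] U. Görtz, T. Wedhorn, *Algebraic Geometry II* (2023), Prop. 27.186, Cor. 27.177 (isogenies are finite locally free; degree).
-/

noncomputable section

universe u

open CategoryTheory CategoryTheory.Limits AlgebraicGeometry MonoidalCategory CartesianMonoidalCategory
open scoped MonObj

namespace Literature.AlgebraicGeometry.AbelianSchemes

namespace AbelianSchemeOver

open Literature.AlgebraicGeometry.RelativeSpec

/-- Plumbing: if `ψ ≫ h = φ` with `ψ` surjective, the fibres of `h` lie in the `ψ`-images of the fibres of `φ`; so they are finite when those of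
`φ` are. [cite: GortzWedhorn2023, Cor. 27.177] -/
theorem finite_preimage_singleton_of_comp {X Y Z : Scheme.{u}} (ψ : X ⟶ Y) (h : Y ⟶ Z) (φ : X ⟶ Z) (hc : ψ ≫ h = φ)
    (hψ : Function.Surjective ψ.base) (hφ : ∀ z, (φ.base ⁻¹' {z}).Finite) (z : Z) : (h.base ⁻¹' {z}).Finite := by
  refine ((hφ z).image ψ.base).subset fun y hy => ?_
  obtain ⟨x, rfl⟩ := hψ y
  refine ⟨x, ?_, rfl⟩
  rw [Set.mem_preimage, Set.mem_singleton_iff] at hy ⊢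
  rw [← hc]
  exact hy

variable {k : Type u} [Field k] (A : AbelianSchemeOver (Spec (CommRingCat.of k))) (K : Subgroup A.Sections) [Finite K]
  (hcov : ∀ x : A.left, ∃ O : (A.translationActionOver (𝟙 (Spec (CommRingCat.of k))) K).StableAffineOpens, x ∈ O.1)
  (hfree : ∀ (Ω : Type u) [Field Ω] [IsAlgClosed Ω] (x : Spec (.of Ω) ⟶ A.left) (σ : K), σ ≠ 1 →
    x ≫ (A.translation (σ : A.Sections)).left ≠ x)
  {B : AbelianSchemeOver (Spec (CommRingCat.of k))} (φ : A.X ⟶ B.X) (hφ : ∀ σ : K, A.translation (σ : A.Sections) ≫ φ = φ)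

include hfree in
/-- **AN ISOGENY KILLING THE FINITE CONSTANT SUBGROUP `K` AND OF DEGREE `|K|` IS THE QUOTIENT** ([MumfordAV1970] §7 Thm. 4, uniqueness of `A⁄K`, in
RANK form).  `A`, `B` abelian schemes over a field `k`, `K ≤ A(k)` finite and free on geometric points, `φ : A → B` a `K`-invariant morphism over
`Spec k` which is FINITE, FLAT and of rank `|K|` at every point of `B`; then `homDesc φ : A⁄K ⟶ B` is an isomorphism in `Over (Spec k)`.
[cite: MumfordAV1970, §7 Thm. 4 (p. 72)] [cite: GortzWedhorn2023, Cor. 27.177] -/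
theorem isIso_homDesc_of_finrank_eq_natCard [IsSeparated (A.X.hom ≫ 𝟙 (Spec (CommRingCat.of k)))] [B.X.left.IsSeparated]
    [IsFinite φ.left] [Flat φ.left] (hrank : ∀ b : B.left, φ.left.finrank b = Nat.card K) :
    IsIso (A.homDesc (𝟙 (Spec (CommRingCat.of k))) K hcov φ hφ) := by
  classical
  letI : Fintype K := Fintype.ofFinite K
  haveI := A.isProper
  haveI := A.isSmooth
  haveI := B.isProper
  -- the quotient map `ψ` and the descended map `h`
  set ψ := A.quotientMk (𝟙 (Spec (CommRingCat.of k))) K hcov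
  set h := A.homDesc (𝟙 (Spec (CommRingCat.of k))) K hcov φ hφ
  have hcomp : ψ ≫ h = φ := A.quotientMk_comp_homDesc _ K hcov φ hφ
  have hcompl : ψ.left ≫ h.left = φ.left := by rw [← Over.comp_left, hcomp]
  -- `ψ` is a free finite étale quotient of rank `|K|`
  have hq := A.isGeometricQuotient_quotientActionOver (𝟙 (Spec (CommRingCat.of k))) K hcov
  have hfr := A.quotientActionOver_free (𝟙 (Spec (CommRingCat.of k))) K hcov hfree
  haveI : IsAffineHom ψ.left := A.isAffineHom_quotientMk_left _ K hcov
  haveI : IsFinite ψ.left := hq.isFinite_of_free hfr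
  haveI : Flat ψ.left := hq.flat_of_free hfr
  haveI : Surjective ψ.left := ⟨A.quotientMk_left_surjective _ K hcov⟩
  have hrkψ : ∀ y, ψ.left.finrank y = Nat.card K := fun y => hq.finrank_eq_natCard_of_free hfr y
  -- `h` is flat
  haveI : Flat (ψ.left ≫ h.left) := by rw [hcompl]; infer_instance
  haveI : Flat h.left := Morphisms.Flat.of_comp_of_surjective ψ.left h.left
  -- `h` is proper with finite fibres, hence finite
  haveI : IsProper (A.quotientOver (𝟙 (Spec (CommRingCat.of k))) K).hom := A.isProper_quotientOver_hom _ K hcov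
  haveI : IsProper (h.left ≫ B.X.hom) := by rw [Over.w h]; infer_instance
  haveI : IsProper h.left := IsProper.of_comp h.left B.X.hom
  haveI : LocallyQuasiFinite h.left :=
    LocallyQuasiFinite.of_finite_preimage_singleton _
      (finite_preimage_singleton_of_comp ψ.left h.left φ.left hcompl (A.quotientMk_left_surjective _ K hcov)
        (fun b => φ.left.finite_preimage_singleton b))
  haveI : IsFinite h.left := IsFinite.of_isProper_of_locallyQuasiFinite _
  -- ranks multiply along `ψ ≫ h = φ`
  have h1 : ∀ b : B.left, h.left.finrank b = 1 := fun b => by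
    have hm := Morphisms.finrank_comp_eq_mul ψ.left h.left b (Nat.card K) (fun y _ => hrkψ y)
    rw [hcompl, hrank b] at hm
    have hpos : (Nat.card K) ≠ 0 := Nat.card_pos.ne'
    exact (mul_eq_left₀ hpos).mp hm.symm
  haveI : IsIso ((Over.forget (Spec (CommRingCat.of k))).map h) :=
    (Scheme.Hom.isIso_iff_finrank_eq h.left).mpr (funext h1)
  exact isIso_of_reflects_iso h (Over.forget _)

include hfree in
/-- The same on underlying schemes: `(homDesc φ).left : (A⁄K).left ⟶ B.left` is an isomorphism. [cite: MumfordAV1970, §7 Thm. 4 (p. 72)] -/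
theorem isIso_left_homDesc_of_finrank_eq_natCard [IsSeparated (A.X.hom ≫ 𝟙 (Spec (CommRingCat.of k)))] [B.X.left.IsSeparated]
    [IsFinite φ.left] [Flat φ.left] (hrank : ∀ b : B.left, φ.left.finrank b = Nat.card K) :
    IsIso (A.homDesc (𝟙 (Spec (CommRingCat.of k))) K hcov φ hφ).left :=
  haveI := A.isIso_homDesc_of_finrank_eq_natCard K hcov hfree φ hφ hrank
  (inferInstance : IsIso ((Over.forget (Spec (CommRingCat.of k))).map (A.homDesc (𝟙 (Spec (CommRingCat.of k))) K hcov φ hφ)))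

/-! ### §2 (ED. 2, desk F0P6c-plan 14:39:04Z) Over a field the freeness clause `hfree` is automatic

A translation `t_σ`, `σ ∈ A(k)`, fixing a geometric point `x̄` over `s̄ : Spec Ω → Spec k` has `σ(s̄) · x̄ = x̄`, so `σ(s̄) = 1`
(★ `forall_comp_translation_ne_of_forall_restrict_ne`); and `σ ↦ σ(s̄)` is injective because `Spec Ω → Spec k` is an
EPIMORPHISM of schemes (flat and surjective).  Hence the hypothesis-light head `isIso_homDesc_of_finrank_eq_natCard_of_field`. -/

/-- A field-valued point `s : Spec Ω → Spec k` of the spectrum of a field is an epimorphism of schemes (flat — the target is a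
reduced point — and surjective; Mathlib `Flat.epi_of_flat_of_surjective`). [cite: GortzWedhorn2023, Cor. 27.177] -/
theorem epi_fieldPoint {Ω : Type u} [Field Ω] (s : Spec (CommRingCat.of Ω) ⟶ Spec (CommRingCat.of k)) : Epi s :=
  haveI : Surjective s := ⟨fun _ => ⟨IsLocalRing.closedPoint Ω, Subsingleton.elim _ _⟩⟩
  Flat.epi_of_flat_of_surjective s

/-- **Over a field, restriction of sections to a field-valued point is injective**: `σ(s̄) = τ(s̄) ⇒ σ = τ` for sections
`σ, τ ∈ A(k)` and any `s̄ : Spec Ω → Spec k` (`(σ(s̄)).left = s̄ ≫ σ.left` and `s̄` is an epimorphism).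
[cite: MumfordAV1970, §7 Thm. 4 (p. 72)] -/
theorem restrict_injective_of_field {Ω : Type u} [Field Ω] (s : Spec (CommRingCat.of Ω) ⟶ Spec (CommRingCat.of k)) :
    Function.Injective (A.restrict s) := by
  intro σ τ h
  have hl : s ≫ σ.left = s ≫ τ.left := congrArg CommaMorphism.left h
  haveI := epi_fieldPoint (k := k) s
  exact Over.OverMorphism.ext ((cancel_epi s).mp hl)

omit [Finite K] in
/-- **Over a field every finite subgroup of rational points acts freely by translations on geometric points**: no translation
`t_σ`, `σ ≠ 1` in `K ≤ A(k)`, fixes a geometric point of `A` (★ `forall_comp_translation_ne_of_forall_restrict_ne` +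
`restrict_injective_of_field`) — the clause `hfree` of the quotient files, DISCHARGED over `Spec k`.
[cite: MumfordAV1970, §7 Thm. 4 (p. 72)] [cite: SGA1, Exp. V Prop. 2.6 (i), Déf. 2.7] -/
theorem translation_free_of_field :
    ∀ (Ω : Type u) [Field Ω] [IsAlgClosed Ω] (x : Spec (.of Ω) ⟶ A.left) (σ : K), σ ≠ 1 →
      x ≫ (A.translation (σ : A.Sections)).left ≠ x :=
  A.forall_comp_translation_ne_of_forall_restrict_ne K fun _Ω _ _ s _σ _ hσ h =>
    hσ (A.restrict_injective_of_field s (h.trans (MonObj.comp_one _)))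

/-- **AN ISOGENY KILLING `K` AND OF DEGREE `|K|` IS THE QUOTIENT — FIELD FORM, `hfree` DISCHARGED** (the name HEART (c3b) ∕ DICT
(c2) cite): `A`, `B` abelian schemes over a field `k`, `K ≤ A(k)` finite, `φ : A → B` `K`-invariant, finite, flat, of rank `|K|`
everywhere ⇒ `homDesc φ : A⁄K ⥲ B`. [cite: MumfordAV1970, §7 Thm. 4 (p. 72)] [cite: GortzWedhorn2023, Cor. 27.177] -/
theorem isIso_homDesc_of_finrank_eq_natCard_of_field [IsSeparated (A.X.hom ≫ 𝟙 (Spec (CommRingCat.of k)))]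
    [B.X.left.IsSeparated] [IsFinite φ.left] [Flat φ.left] (hrank : ∀ b : B.left, φ.left.finrank b = Nat.card K) :
    IsIso (A.homDesc (𝟙 (Spec (CommRingCat.of k))) K hcov φ hφ) :=
  A.isIso_homDesc_of_finrank_eq_natCard K hcov (A.translation_free_of_field K) φ hφ hrank

/-- The same on underlying schemes, `hfree` discharged. [cite: MumfordAV1970, §7 Thm. 4 (p. 72)] -/
theorem isIso_left_homDesc_of_finrank_eq_natCard_of_field [IsSeparated (A.X.hom ≫ 𝟙 (Spec (CommRingCat.of k)))]
    [B.X.left.IsSeparated] [IsFinite φ.left] [Flat φ.left] (hrank : ∀ b : B.left, φ.left.finrank b = Nat.card K) :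
    IsIso (A.homDesc (𝟙 (Spec (CommRingCat.of k))) K hcov φ hφ).left :=
  A.isIso_left_homDesc_of_finrank_eq_natCard K hcov (A.translation_free_of_field K) φ hφ hrank

end AbelianSchemeOver

end Literature.AlgebraicGeometry.AbelianSchemes

end
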